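import Mathlib
import HarnessLib

/-!
# A Newton–Kantorovich zero test for analytic functions on a disc

A quantitative existence test for a zero of a complex-analytic function near an approximate zero, in the form
used by validated numerics (a one-step interval Newton / Krawczyk argument, here with the derivative bound taken
from **Cauchy's estimate**): if `F` is analytic on a neighbourhood of the closed disc `D̄(c, R + ρ)` and bounded
there by `B`, then `‖F''‖ ≤ M := 2B/R²` on `D̄(c, ρ)` (`norm_iteratedDeriv_two_le`), so `F'` is `M`-Lipschitz
there; if moreover `λ` is a number with `‖F'(c) − λ‖ ≤ e`, `e + Mρ < ‖λ‖` and `‖F(c)‖ ≤ (‖λ‖ − e − Mρ)·ρ`, then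
the simplified Newton map `g(z) = z − F(z)/λ` is a contraction of `D̄(c, ρ)` into itself, whence `F` has a zero
in `D̄(c, ρ)` (`exists_zero_of_newton_contraction`, Banach's fixed point theorem).  The derivative may be
replaced by a central difference: `‖(F(c+δ) − F(c−δ))/(2δ) − F'(c)‖ ≤ Mδ` (`norm_centralDiff_sub_deriv_le`),
giving the purely "point-value" test `exists_zero_of_newton_test`, whose hypotheses are three values of `F`,
one sup bound, and four real inequalities — the shape a kernel-checked interval computation can discharge.

References: L. V. Kantorovich, *On Newton's method for functional equations*, Dokl. Akad. Nauk SSSR 59 (1948)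
1237–1240; R. Krawczyk, *Newton-Algorithmen zur Bestimmung von Nullstellen mit Fehlerschranken*, Computing 4
(1969) 187–201; S. M. Rump, *Verification methods: rigorous results using floating-point arithmetic*, Acta
Numerica 19 (2010) 287–449, §13. [folklore]

First consumer: the unconditional certificate for Haglund's Conjecture 1 at `N = 27`
(`Literature/NumberTheory/LFunctions/Haglund2011/`), refutations bundle `papers/_cross/refutations`, item (x).
AI-produced formalisation (H21 seat pub-refute-2, 2026-08-19).
-/

set_option autoImplicit false

open Metric Set Filter Topology

namespace Literature.Analysis.Complex

variable {F : ℂ → ℂ} {U : Set ℂ}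

/-- A closed disc of radius `R` about a point of `D̄(c, ρ)` lies in `D̄(c, R + ρ)`. [folklore] -/
lemma closedBall_subset_closedBall_add {c z : ℂ} {R ρ : ℝ} (hz : z ∈ closedBall c ρ) :
    closedBall z R ⊆ closedBall c (R + ρ) := by
  intro w hw
  rw [mem_closedBall] at hw hz ⊢
  calc dist w c ≤ dist w z + dist z c := dist_triangle _ _ _
    _ ≤ R + ρ := add_le_add hw hz

/-- **Cauchy's estimate for the second derivative, uniformly on a smaller disc**: if `F` is differentiable
on an open `U ⊇ D̄(c, R + ρ)` and `‖F‖ ≤ B` on `D̄(c, R + ρ)`, then `‖F''(z)‖ ≤ 2B/R²` for `z ∈ D̄(c, ρ)`.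
[folklore] -/
theorem norm_iteratedDeriv_two_le (hU : IsOpen U) (hF : DifferentiableOn ℂ F U) {c : ℂ} {R ρ B : ℝ}
    (hR : 0 < R) (hsub : closedBall c (R + ρ) ⊆ U) (hB : ∀ w ∈ closedBall c (R + ρ), ‖F w‖ ≤ B)
    {z : ℂ} (hz : z ∈ closedBall c ρ) : ‖iteratedDeriv 2 F z‖ ≤ 2 * B / R ^ 2 := by
  have _ := hU
  have hzR := closedBall_subset_closedBall_add (R := R) hz
  have hd : DiffContOnCl ℂ F (ball z R) := by
    apply DifferentiableOn.diffContOnCl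
    rw [closure_ball z hR.ne']
    exact hF.mono (hzR.trans hsub)
  have hC : ∀ w ∈ sphere z R, ‖F w‖ ≤ B := fun w hw ↦ hB w (hzR (sphere_subset_closedBall hw))
  have := Complex.norm_iteratedDeriv_le_of_forall_mem_sphere_norm_le 2 hR hd hC
  simpa [Nat.factorial] using this

/-- Under the same hypotheses `F'` is `2B/R²`-Lipschitz on `D̄(c, ρ)`:
`‖F'(y) − F'(x)‖ ≤ (2B/R²)·‖y − x‖`. [folklore] -/
theorem norm_deriv_sub_deriv_le (hU : IsOpen U) (hF : DifferentiableOn ℂ F U) {c : ℂ} {R ρ B : ℝ}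
    (hR : 0 < R) (hsub : closedBall c (R + ρ) ⊆ U)
    (hB : ∀ w ∈ closedBall c (R + ρ), ‖F w‖ ≤ B) {x y : ℂ} (hx : x ∈ closedBall c ρ)
    (hy : y ∈ closedBall c ρ) : ‖deriv F y - deriv F x‖ ≤ 2 * B / R ^ 2 * ‖y - x‖ := by
  have hDU : closedBall c ρ ⊆ U := by
    refine Subset.trans ?_ hsub
    exact closedBall_subset_closedBall (by linarith)
  have hF' : DifferentiableOn ℂ (deriv F) U := ((hF.analyticOnNhd hU).deriv).differentiableOn
  refine Convex.norm_image_sub_le_of_norm_deriv_le (f := deriv F) (s := closedBall c ρ)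
    (fun w hw ↦ (hF' w (hDU hw)).differentiableAt (hU.mem_nhds (hDU hw))) (fun w hw ↦ ?_)
    (convex_closedBall c ρ) hx hy
  have h2 := norm_iteratedDeriv_two_le hU hF hR hsub hB hw
  rwa [iteratedDeriv_succ, iteratedDeriv_one] at h2

/-- **Newton–Kantorovich / interval-Newton zero test (derivative form).** If `F` is differentiable on an open
`U ⊇ D̄(c, R + ρ)`, `‖F‖ ≤ B` there, `‖F'(c) − λ‖ ≤ e`, `e + (2B/R²)ρ < ‖λ‖` and
`‖F(c)‖ ≤ (‖λ‖ − e − (2B/R²)ρ)·ρ`, then `F` has a zero in `D̄(c, ρ)`. (Proof: `z ↦ z − F(z)/λ` is a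
`((e + (2B/R²)ρ)/‖λ‖)`-contraction of the complete set `D̄(c, ρ)` into itself.) [folklore] -/
theorem exists_zero_of_newton_contraction (hU : IsOpen U) (hF : DifferentiableOn ℂ F U) {c lam : ℂ}
    {R ρ B e : ℝ} (hR : 0 < R) (hρ : 0 < ρ) (hsub : closedBall c (R + ρ) ⊆ U)
    (hB : ∀ w ∈ closedBall c (R + ρ), ‖F w‖ ≤ B) (he : ‖deriv F c - lam‖ ≤ e)
    (hcontr : e + 2 * B / R ^ 2 * ρ < ‖lam‖) (hFc : ‖F c‖ ≤ (‖lam‖ - (e + 2 * B / R ^ 2 * ρ)) * ρ) :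
    ∃ z ∈ closedBall c ρ, F z = 0 := by
  set M : ℝ := 2 * B / R ^ 2 with hM
  have he0 : 0 ≤ e := le_trans (norm_nonneg _) he
  have hB0 : 0 ≤ B := le_trans (norm_nonneg _) (hB c (mem_closedBall_self (by linarith)))
  have hM0 : 0 ≤ M := by rw [hM]; positivity
  have hlam0 : 0 < ‖lam‖ := lt_of_le_of_lt (by positivity) hcontr
  have hlam : lam ≠ 0 := norm_pos_iff.1 hlam0
  set L : ℝ := (e + M * ρ) / ‖lam‖ with hL
  have hL0 : 0 ≤ L := by rw [hL]; positivity
  have hL1 : L < 1 := by rw [hL, div_lt_one hlam0]; exact hcontr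
  have hDU : closedBall c ρ ⊆ U := by
    refine Subset.trans ?_ hsub
    exact closedBall_subset_closedBall (by linarith)
  -- the Newton map
  set g : ℂ → ℂ := fun z ↦ z - F z / lam with hg
  have hgd : ∀ z ∈ closedBall c ρ, DifferentiableAt ℂ g z := fun z hz ↦ by
    have hFz : DifferentiableAt ℂ F z := (hF z (hDU hz)).differentiableAt (hU.mem_nhds (hDU hz))
    exact (differentiableAt_id.sub (hFz.div_const lam))
  have hgderiv : ∀ z ∈ closedBall c ρ, deriv g z = 1 - deriv F z / lam := fun z hz ↦ by
    have hFz : DifferentiableAt ℂ F z := (hF z (hDU hz)).differentiableAt (hU.mem_nhds (hDU hz))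
    have h : HasDerivAt (fun w : ℂ ↦ w - F w / lam) (1 - deriv F z / lam) z :=
      (hasDerivAt_id' z).sub (hFz.hasDerivAt.div_const lam)
    show deriv (fun w : ℂ ↦ w - F w / lam) z = _
    exact h.deriv
  -- `‖g'‖ ≤ L` on the disc
  have hgbound : ∀ z ∈ closedBall c ρ, ‖deriv g z‖ ≤ L := fun z hz ↦ by
    rw [hgderiv z hz]
    have h1 : (1 : ℂ) - deriv F z / lam = (lam - deriv F z) / lam := by field_simp
    rw [h1, norm_div, div_le_div_iff_of_pos_right hlam0]
    have h2 : ‖deriv F z - deriv F c‖ ≤ M * ‖z - c‖ :=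
      norm_deriv_sub_deriv_le hU hF hR hsub hB (mem_closedBall_self hρ.le) hz
    have h3 : ‖z - c‖ ≤ ρ := by rwa [mem_closedBall, dist_eq_norm] at hz
    calc ‖lam - deriv F z‖ = ‖(lam - deriv F c) - (deriv F z - deriv F c)‖ := by ring_nf
      _ ≤ ‖lam - deriv F c‖ + ‖deriv F z - deriv F c‖ := norm_sub_le _ _
      _ ≤ e + M * ρ := by
          rw [norm_sub_rev] at he
          exact add_le_add he (h2.trans (mul_le_mul_of_nonneg_left h3 hM0))
  -- Lipschitz with constant `L` on the disc
  have hLip : ∀ x ∈ closedBall c ρ, ∀ y ∈ closedBall c ρ, ‖g y - g x‖ ≤ L * ‖y - x‖ :=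
    fun x hx y hy ↦ Convex.norm_image_sub_le_of_norm_deriv_le hgd hgbound (convex_closedBall c ρ) hx hy
  -- maps the disc into itself
  have hgc : ‖g c - c‖ ≤ (1 - L) * ρ := by
    have : g c - c = -(F c / lam) := by simp [hg]
    rw [this, norm_neg, norm_div, div_le_iff₀ hlam0]
    have hL' : (1 - L) * ρ * ‖lam‖ = (‖lam‖ - (e + M * ρ)) * ρ := by
      rw [hL]; field_simp
    rw [hL']
    exact hFc
  have hmaps : MapsTo g (closedBall c ρ) (closedBall c ρ) := fun z hz ↦ by
    rw [mem_closedBall, dist_eq_norm]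
    have h3 : ‖z - c‖ ≤ ρ := by rwa [mem_closedBall, dist_eq_norm] at hz
    calc ‖g z - c‖ = ‖(g z - g c) + (g c - c)‖ := by ring_nf
      _ ≤ ‖g z - g c‖ + ‖g c - c‖ := norm_add_le _ _
      _ ≤ L * ‖z - c‖ + (1 - L) * ρ := add_le_add (hLip c (mem_closedBall_self hρ.le) z hz) hgc
      _ ≤ L * ρ + (1 - L) * ρ := by gcongr
      _ = ρ := by ring
  -- Banach fixed point on the complete set `D̄(c, ρ)`
  have hLipOn : LipschitzOnWith (Real.toNNReal L) g (closedBall c ρ) := by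
    refine LipschitzOnWith.of_dist_le_mul fun x hx y hy ↦ ?_
    rw [dist_eq_norm, dist_eq_norm, Real.coe_toNNReal _ hL0]
    exact hLip y hy x hx
  have hK : ContractingWith (Real.toNNReal L) (hmaps.restrict g (closedBall c ρ) (closedBall c ρ)) :=
    ⟨by simpa using hL1, hLipOn.mapsToRestrict hmaps⟩
  obtain ⟨y, hy, hfix, -⟩ := ContractingWith.exists_fixedPoint' (isClosed_closedBall.isComplete) hmaps hK
    (mem_closedBall_self hρ.le) (edist_ne_top _ _)
  refine ⟨y, hy, ?_⟩
  have h := hfix.eq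
  simp only [hg, sub_eq_self, div_eq_zero_iff] at h
  exact h.resolve_right hlam

/-- **Central difference vs derivative**: if `‖F''‖ ≤ M` on `D̄(c, δ)` (through the Lipschitz bound
`‖F'(w) − F'(c)‖ ≤ M‖w − c‖`), then `‖(F(c+δ) − F(c−δ))/(2δ) − F'(c)‖ ≤ Mδ`. [folklore] -/
theorem norm_centralDiff_sub_deriv_le {c : ℂ} {δ M : ℝ} (hδ : 0 < δ)
    (hd : ∀ w ∈ closedBall c δ, DifferentiableAt ℂ F w)
    (hM : ∀ w ∈ closedBall c δ, ‖deriv F w - deriv F c‖ ≤ M * ‖w - c‖) :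
    ‖(F (c + δ) - F (c - δ)) / (2 * δ) - deriv F c‖ ≤ M * δ := by
  have hM0 : 0 ≤ M := by
    have h := hM (c + δ) (by simp [mem_closedBall, abs_of_pos hδ])
    have hn : (0 : ℝ) ≤ ‖deriv F (c + δ) - deriv F c‖ := norm_nonneg _
    have hδ' : ‖(c + δ : ℂ) - c‖ = δ := by simp [abs_of_pos hδ]
    rw [hδ'] at h
    nlinarith
  -- `φ(w) = F(w) − F'(c)(w − c)` has `‖φ'‖ ≤ Mδ` on the disc
  set φ : ℂ → ℂ := fun w ↦ F w - deriv F c * (w - c) with hφ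
  have hφd : ∀ w ∈ closedBall c δ, DifferentiableAt ℂ φ w := fun w hw ↦
    (hd w hw).sub ((differentiableAt_id.sub_const c).const_mul _)
  have hφ' : ∀ w ∈ closedBall c δ, ‖deriv φ w‖ ≤ M * δ := fun w hw ↦ by
    have h := ((hd w hw).hasDerivAt.sub (((hasDerivAt_id w).sub_const c).const_mul (deriv F c))).deriv
    simp only [mul_one] at h
    rw [show deriv φ w = deriv F w - deriv F c from h]
    have h3 : ‖w - c‖ ≤ δ := by rwa [mem_closedBall, dist_eq_norm] at hw
    exact (hM w hw).trans (mul_le_mul_of_nonneg_left h3 hM0)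
  have hp : (c : ℂ) + δ ∈ closedBall c δ := by simp [mem_closedBall, abs_of_pos hδ]
  have hm : (c : ℂ) - δ ∈ closedBall c δ := by simp [mem_closedBall, abs_of_pos hδ]
  have key := Convex.norm_image_sub_le_of_norm_deriv_le hφd hφ' (convex_closedBall c δ) hm hp
  have hdiff : φ (c + δ) - φ (c - δ) = (F (c + δ) - F (c - δ)) - deriv F c * (2 * δ) := by
    simp only [hφ]; ring
  have hnorm : ‖(c + δ : ℂ) - (c - δ)‖ = 2 * δ := by
    rw [show (c + δ : ℂ) - (c - δ) = ((2 * δ : ℝ) : ℂ) by push_cast; ring, Complex.norm_real,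
      Real.norm_eq_abs, abs_of_pos (by positivity)]
  rw [hdiff, hnorm] at key
  have h2δ : (0 : ℝ) < 2 * δ := by positivity
  have hδC : (δ : ℂ) ≠ 0 := by exact_mod_cast hδ.ne'
  have : (F (c + δ) - F (c - δ)) / (2 * δ) - deriv F c =
      ((F (c + δ) - F (c - δ)) - deriv F c * (2 * δ)) / ((2 * δ : ℝ) : ℂ) := by
    push_cast
    field_simp
  rw [this, norm_div, Complex.norm_real, Real.norm_eq_abs, abs_of_pos h2δ, div_le_iff₀ h2δ]
  calc ‖F (c + δ) - F (c - δ) - deriv F c * (2 * δ)‖ ≤ M * δ * (2 * δ) := key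
    _ = M * δ * (2 * δ) := rfl

/-- **The point-value zero test.** `F` differentiable on an open `U ⊇ D̄(c, R + ρ)` with `‖F‖ ≤ B` there;
`0 < δ ≤ ρ`; a number `λ` with `‖(F(c+δ) − F(c−δ))/(2δ) − λ‖ ≤ e`; and, with `M = 2B/R²`,
`e + M(δ + ρ) < ‖λ‖` and `‖F(c)‖ ≤ (‖λ‖ − e − M(δ + ρ))·ρ`.  Then `F` vanishes somewhere in `D̄(c, ρ)`.
[folklore] -/
theorem exists_zero_of_newton_test (hU : IsOpen U) (hF : DifferentiableOn ℂ F U) {c lam : ℂ}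
    {R ρ δ B e : ℝ} (hR : 0 < R) (hρ : 0 < ρ) (hδ : 0 < δ) (hδρ : δ ≤ ρ)
    (hsub : closedBall c (R + ρ) ⊆ U) (hB : ∀ w ∈ closedBall c (R + ρ), ‖F w‖ ≤ B)
    (he : ‖(F (c + δ) - F (c - δ)) / (2 * δ) - lam‖ ≤ e)
    (hcontr : e + 2 * B / R ^ 2 * (δ + ρ) < ‖lam‖)
    (hFc : ‖F c‖ ≤ (‖lam‖ - (e + 2 * B / R ^ 2 * (δ + ρ))) * ρ) :
    ∃ z ∈ closedBall c ρ, F z = 0 := by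
  set M : ℝ := 2 * B / R ^ 2 with hM
  have hDU : closedBall c ρ ⊆ U := by
    refine Subset.trans ?_ hsub
    exact closedBall_subset_closedBall (by linarith)
  have hdd : ∀ w ∈ closedBall c δ, DifferentiableAt ℂ F w := fun w hw ↦ by
    have hw' : w ∈ closedBall c ρ := closedBall_subset_closedBall hδρ hw
    exact (hF w (hDU hw')).differentiableAt (hU.mem_nhds (hDU hw'))
  have hLipd : ∀ w ∈ closedBall c δ, ‖deriv F w - deriv F c‖ ≤ M * ‖w - c‖ := fun w hw ↦
    norm_deriv_sub_deriv_le hU hF hR hsub hB (mem_closedBall_self hρ.le)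
      (closedBall_subset_closedBall hδρ hw)
  have hfd := norm_centralDiff_sub_deriv_le hδ hdd hLipd
  have he' : ‖deriv F c - lam‖ ≤ e + M * δ := by
    calc ‖deriv F c - lam‖
        = ‖((F (c + δ) - F (c - δ)) / (2 * δ) - lam) - ((F (c + δ) - F (c - δ)) / (2 * δ) - deriv F c)‖ := by
          ring_nf
      _ ≤ ‖(F (c + δ) - F (c - δ)) / (2 * δ) - lam‖ + ‖(F (c + δ) - F (c - δ)) / (2 * δ) - deriv F c‖ :=
          norm_sub_le _ _
      _ ≤ e + M * δ := add_le_add he hfd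
  refine exists_zero_of_newton_contraction hU hF hR hρ hsub hB he' ?_ ?_
  · calc e + M * δ + 2 * B / R ^ 2 * ρ = e + M * (δ + ρ) := by rw [hM]; ring
      _ < ‖lam‖ := hcontr
  · calc ‖F c‖ ≤ (‖lam‖ - (e + M * (δ + ρ))) * ρ := hFc
      _ = (‖lam‖ - (e + M * δ + 2 * B / R ^ 2 * ρ)) * ρ := by rw [hM]; ring

end Literature.Analysis.Complex
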